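import Mathlib
import HarnessLib
import Summits.Ventures.LatticeQCDFlow.Scoring.KArmHomogeneityCoverage
import Summits.Ventures.LatticeQCDFlow.Scoring.SimultaneousAgreementIndependentColumns

/-!
# THE `k`-ARM HOMOGENEITY TEST AT SEVERAL INDEPENDENT COUPLINGS: THE TABLE PASSES WITH PROBABILITY
# `→ G(c)^J`, AND THE ŠIDÁK THRESHOLD `c_J(L)` WITH `G(c_J(L))^J = L` EXISTS AND IS UNIQUE

HONEST FRAMING: exact (Metropolis-corrected) sampling algorithms for lattice gauge theory;
figures of merit are autocorrelation/cost numbers at stated couplings and volumes; no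
continuum-physics claim.

Venture `LatticeQCDFlow` (cell pub-lqcd), topic `Scoring`; FANOUT row 4 (`s0-u1-b`, GEN-35).
NEW WORK of the cell (textbook; our formalisation), no definition, nothing cited as a fact
(Šidák's correction NAMED ONLY; `G` is the `χ²_{R−1}` distribution function NAMED ONLY).

WHY (row 4: "at every β").  `Scoring/KArmHomogeneityCoverage` calibrates ONE coupling's one-shot
`k`-arm test: `P(Qₖ ≤ c) → G(c) := N(0,1)^{⊗R}{z | Σ_{r≠0} z_r² ≤ c}`.  The card asks for agreement at
EVERY one of `J` couplings, run as independent jobs.  By the product law of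
`Scoring/SimultaneousAgreementIndependentColumns` the whole table passes with probability
`→ G(c)^J` (**`kArm_homogeneity_simultaneous_coverage`**).  To calibrate the table at a level `L` one
needs the per-coupling threshold `c_J(L)` with `G(c_J(L))^J = L`; this file proves it EXISTS AND IS
UNIQUE for every `J ≠ 0` and `L ∈ (0,1)` (**`existsUnique_kArm_sidak_threshold`**), from three
properties of `G` proved here: `G` is CONTINUOUS (the law of `Σ_{r≠0} z_r²` has no atoms,
`Scoring/KArmHomogeneityGaussian`, so its distribution function has no jumps —
**`continuous_measureReal_Iic_of_measure_singleton`**, via `leftLim`/`rightLim` of the Stieltjes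
c.d.f.), STRICTLY INCREASING on `[0, ∞)` (the Gaussian product charges every shell
`{c < Σ_{r≠0} z_r² < c'}`, **`pi_gaussianReal_sumSqErase_strictMonoOn`**), with `G(0) = 0` and
`G(c) → 1` (**`tendsto_pi_gaussianReal_sumSqErase_atTop`**); and the threshold is increasing in the
demanded table level and in `J` (**`kArm_sidak_threshold_lt_of_pow_lt`**).

NOT CLAIMED: the numerical value of `c_J(L)` (a `χ²` quantile); dependent couplings.
-/

open MeasureTheory ProbabilityTheory Filter Topology Finset

namespace Summit.Ventures.LatticeQCDFlow.Scoring

open Set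

/-! ## §1 A distribution function without atoms is continuous -/

section CDF

/-- **No atoms ⇒ continuous distribution function**: for a probability measure `ν` on `ℝ` with
`ν{c} = 0` for every `c`, `c ↦ ν((−∞, c])` is continuous. [folklore] -/
theorem continuous_measureReal_Iic_of_measure_singleton (ν : Measure ℝ) [IsProbabilityMeasure ν]
    (h0 : ∀ c : ℝ, ν {c} = 0) : Continuous fun c : ℝ => ν.real (Iic c) := by
  have hcdf : (fun c : ℝ => ν.real (Iic c)) = fun c => cdf ν c := by
    funext c
    exact (cdf_eq_real ν c).symm
  rw [hcdf]
  refine continuous_iff_continuousAt.2 fun c => ?_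
  rw [(monotone_cdf ν).continuousAt_iff_leftLim_eq_rightLim]
  have hright : Function.rightLim (cdf ν) c = cdf ν c := (cdf ν).rightLim_eq c
  have hsing := (cdf ν).measure_singleton c
  rw [measure_cdf, h0 c] at hsing
  have hle : Function.leftLim (cdf ν) c ≤ cdf ν c := (monotone_cdf ν).leftLim_le le_rfl
  have hge : cdf ν c - Function.leftLim (cdf ν) c ≤ 0 := ENNReal.ofReal_eq_zero.1 hsing.symm
  rw [hright]
  linarith

end CDF

/-! ## §2 The null functional `G(c) = N^{⊗ι}{Σ_{r≠r₀} z_r² ≤ c}` as a function of the threshold -/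

section Null

variable {n : ℕ}

/-- `G` as the distribution function of the law of `Σ_{r≠0} z_r²`. -/
theorem pi_gaussianReal_sumSqErase_eq_map_Iic (c : ℝ) :
    (Measure.pi fun _ : Fin (n + 2) => gaussianReal 0 1).real
        {z : Fin (n + 2) → ℝ | ∑ r ∈ univ.erase 0, z r ^ 2 ≤ c}
      = ((Measure.pi fun _ : Fin (n + 2) => gaussianReal 0 1).map
          fun z : Fin (n + 2) → ℝ => ∑ r ∈ univ.erase 0, z r ^ 2).real (Iic c) := by
  rw [measureReal_def, measureReal_def, Measure.map_apply (by fun_prop) measurableSet_Iic]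
  rfl

/-- **`G` IS CONTINUOUS** in the threshold. [ours] -/
theorem continuous_pi_gaussianReal_sumSqErase :
    Continuous fun c : ℝ => (Measure.pi fun _ : Fin (n + 2) => gaussianReal 0 1).real
      {z : Fin (n + 2) → ℝ | ∑ r ∈ univ.erase 0, z r ^ 2 ≤ c} := by
  simp only [pi_gaussianReal_sumSqErase_eq_map_Iic]
  haveI : IsProbabilityMeasure ((Measure.pi fun _ : Fin (n + 2) => gaussianReal 0 1).map
      fun z : Fin (n + 2) → ℝ => ∑ r ∈ univ.erase 0, z r ^ 2) :=
    Measure.isProbabilityMeasure_map (Measurable.aemeasurable (by fun_prop))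
  refine continuous_measureReal_Iic_of_measure_singleton _ fun c => ?_
  rw [Measure.map_apply (by fun_prop) (measurableSet_singleton c)]
  exact pi_gaussianReal_sum_sq_erase_levelSet_eq_zero n c

/-- **`G(0) = 0`** (and `G(c) = 0` for `c ≤ 0`): `R − 1 ≥ 1` squares do not vanish together. [ours] -/
theorem pi_gaussianReal_sumSqErase_nonpos {c : ℝ} (hc : c ≤ 0) :
    (Measure.pi fun _ : Fin (n + 2) => gaussianReal 0 1).real
      {z : Fin (n + 2) → ℝ | ∑ r ∈ univ.erase 0, z r ^ 2 ≤ c} = 0 := by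
  have hsub : {z : Fin (n + 2) → ℝ | ∑ r ∈ univ.erase 0, z r ^ 2 ≤ c}
      ⊆ {z : Fin (n + 2) → ℝ | ∑ r ∈ univ.erase 0, z r ^ 2 = 0} := fun z hz => by
    simp only [Set.mem_setOf_eq] at hz ⊢
    exact le_antisymm (hz.trans hc) (Finset.sum_nonneg fun r _ => sq_nonneg _)
  rw [measureReal_def, measure_mono_null hsub (pi_gaussianReal_sum_sq_erase_levelSet_eq_zero n 0),
    ENNReal.toReal_zero]

/-- **`G(c) → 1` as `c → ∞`.** [ours] -/
theorem tendsto_pi_gaussianReal_sumSqErase_atTop :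
    Tendsto (fun c : ℝ => (Measure.pi fun _ : Fin (n + 2) => gaussianReal 0 1).real
      {z : Fin (n + 2) → ℝ | ∑ r ∈ univ.erase 0, z r ^ 2 ≤ c}) atTop (𝓝 1) := by
  simp only [pi_gaussianReal_sumSqErase_eq_map_Iic]
  haveI : IsProbabilityMeasure ((Measure.pi fun _ : Fin (n + 2) => gaussianReal 0 1).map
      fun z : Fin (n + 2) → ℝ => ∑ r ∈ univ.erase 0, z r ^ 2) :=
    Measure.isProbabilityMeasure_map (Measurable.aemeasurable (by fun_prop))
  have h := tendsto_cdf_atTop ((Measure.pi fun _ : Fin (n + 2) => gaussianReal 0 1).map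
      fun z : Fin (n + 2) → ℝ => ∑ r ∈ univ.erase 0, z r ^ 2)
  refine h.congr fun c => ?_
  exact cdf_eq_real _ c

/-- **`G` IS STRICTLY INCREASING ON `[0, ∞)`**: the Gaussian product charges every shell
`{c < Σ_{r≠0} z_r² < c'}`. [ours] -/
theorem pi_gaussianReal_sumSqErase_strictMonoOn :
    StrictMonoOn (fun c : ℝ => (Measure.pi fun _ : Fin (n + 2) => gaussianReal 0 1).real
      {z : Fin (n + 2) → ℝ | ∑ r ∈ univ.erase 0, z r ^ 2 ≤ c}) (Ici 0) := by
  intro c hc c' _ hlt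
  simp only [Set.mem_Ici] at hc
  set μ := (Measure.pi fun _ : Fin (n + 2) => gaussianReal 0 1) with hμ
  haveI : ∀ _i : Fin (n + 2), (gaussianReal (0 : ℝ) 1).IsOpenPosMeasure := fun _ =>
    (gaussianReal_absolutelyContinuous' 0 one_ne_zero).isOpenPosMeasure
  -- the shell is open, non-empty, disjoint from `{≤ c}` and inside `{≤ c'}`
  have hf : Continuous fun z : Fin (n + 2) → ℝ => ∑ r ∈ univ.erase 0, z r ^ 2 := by fun_prop
  have hopen : IsOpen {z : Fin (n + 2) → ℝ | c < ∑ r ∈ univ.erase 0, z r ^ 2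
      ∧ ∑ r ∈ univ.erase 0, z r ^ 2 < c'} := by
    rw [Set.setOf_and]
    exact (isOpen_lt continuous_const hf).inter (isOpen_lt hf continuous_const)
  have hne : ({z : Fin (n + 2) → ℝ | c < ∑ r ∈ univ.erase 0, z r ^ 2
      ∧ ∑ r ∈ univ.erase 0, z r ^ 2 < c'}).Nonempty := by
    refine ⟨fun r => if r = 1 then Real.sqrt ((c + c') / 2) else 0, ?_⟩
    have hsum : ∑ r ∈ univ.erase (0 : Fin (n + 2)),
        (if r = 1 then Real.sqrt ((c + c') / 2) else (0 : ℝ)) ^ 2 = (c + c') / 2 := by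
      rw [Finset.sum_eq_single_of_mem (1 : Fin (n + 2))
        (Finset.mem_erase.2 ⟨one_ne_zero, Finset.mem_univ _⟩) fun r _ hr => by
          rw [if_neg hr]; ring]
      rw [if_pos rfl, Real.sq_sqrt (by linarith)]
    simp only [Set.mem_setOf_eq, hsum]
    constructor <;> linarith
  have hpos := hopen.measure_pos μ hne
  have hdisj : Disjoint {z : Fin (n + 2) → ℝ | ∑ r ∈ univ.erase 0, z r ^ 2 ≤ c}
      {z : Fin (n + 2) → ℝ | c < ∑ r ∈ univ.erase 0, z r ^ 2 ∧ ∑ r ∈ univ.erase 0, z r ^ 2 < c'} := by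
    rw [Set.disjoint_left]
    intro z hz hz'
    simp only [Set.mem_setOf_eq] at hz hz'
    linarith [hz'.1]
  have hsub : {z : Fin (n + 2) → ℝ | ∑ r ∈ univ.erase 0, z r ^ 2 ≤ c}
      ∪ {z : Fin (n + 2) → ℝ | c < ∑ r ∈ univ.erase 0, z r ^ 2 ∧ ∑ r ∈ univ.erase 0, z r ^ 2 < c'}
      ⊆ {z : Fin (n + 2) → ℝ | ∑ r ∈ univ.erase 0, z r ^ 2 ≤ c'} := by
    rintro z (hz | hz)
    · simp only [Set.mem_setOf_eq] at hz ⊢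
      linarith
    · simp only [Set.mem_setOf_eq] at hz ⊢
      exact hz.2.le
  have hshell : MeasurableSet {z : Fin (n + 2) → ℝ | c < ∑ r ∈ univ.erase 0, z r ^ 2
      ∧ ∑ r ∈ univ.erase 0, z r ^ 2 < c'} := hopen.measurableSet
  calc μ.real {z : Fin (n + 2) → ℝ | ∑ r ∈ univ.erase 0, z r ^ 2 ≤ c}
      < μ.real {z : Fin (n + 2) → ℝ | ∑ r ∈ univ.erase 0, z r ^ 2 ≤ c}
        + μ.real {z : Fin (n + 2) → ℝ | c < ∑ r ∈ univ.erase 0, z r ^ 2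
          ∧ ∑ r ∈ univ.erase 0, z r ^ 2 < c'} := by
        have : 0 < μ.real {z : Fin (n + 2) → ℝ | c < ∑ r ∈ univ.erase 0, z r ^ 2
            ∧ ∑ r ∈ univ.erase 0, z r ^ 2 < c'} := by
          rw [measureReal_def, ENNReal.toReal_pos_iff]
          exact ⟨hpos, measure_lt_top _ _⟩
        linarith
    _ = μ.real ({z : Fin (n + 2) → ℝ | ∑ r ∈ univ.erase 0, z r ^ 2 ≤ c}
        ∪ {z : Fin (n + 2) → ℝ | c < ∑ r ∈ univ.erase 0, z r ^ 2 ∧ ∑ r ∈ univ.erase 0, z r ^ 2 < c'}) :=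
        (measureReal_union hdisj hshell).symm
    _ ≤ μ.real {z : Fin (n + 2) → ℝ | ∑ r ∈ univ.erase 0, z r ^ 2 ≤ c'} := measureReal_mono hsub

/-- **THE ŠIDÁK THRESHOLD EXISTS AND IS UNIQUE**: for every number of couplings `J ≠ 0` and every
table level `L ∈ (0, 1)` there is exactly one `c > 0` with `G(c)^J = L`. [ours] -/
theorem existsUnique_kArm_sidak_threshold {L : ℝ} (hL0 : 0 < L) (hL1 : L < 1) {J : ℕ} (hJ : J ≠ 0) :
    ∃! c : ℝ, 0 < c ∧ ((Measure.pi fun _ : Fin (n + 2) => gaussianReal 0 1).real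
      {z : Fin (n + 2) → ℝ | ∑ r ∈ univ.erase 0, z r ^ 2 ≤ c}) ^ J = L := by
  set G : ℝ → ℝ := fun c => (Measure.pi fun _ : Fin (n + 2) => gaussianReal 0 1).real
    {z : Fin (n + 2) → ℝ | ∑ r ∈ univ.erase 0, z r ^ 2 ≤ c} with hG
  set ℓ : ℝ := L ^ ((J : ℝ)⁻¹) with hℓ
  have hℓ0 : 0 < ℓ := Real.rpow_pos_of_pos hL0 _
  have hℓ1 : ℓ < 1 := Real.rpow_lt_one hL0.le hL1 (by positivity)
  have hℓJ : ℓ ^ J = L := Real.rpow_inv_natCast_pow hL0.le hJ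
  have hG0 : G 0 = 0 := pi_gaussianReal_sumSqErase_nonpos le_rfl
  obtain ⟨C, hCpos, hC⟩ : ∃ C : ℝ, 0 < C ∧ ℓ < G C := by
    have h := ((tendsto_pi_gaussianReal_sumSqErase_atTop (n := n)).eventually (lt_mem_nhds hℓ1)).and
      (eventually_gt_atTop 0)
    obtain ⟨C, hC1, hC2⟩ := h.exists
    exact ⟨C, hC2, hC1⟩
  have hIVT : ℓ ∈ G '' Icc 0 C :=
    intermediate_value_Icc hCpos.le (continuous_pi_gaussianReal_sumSqErase.continuousOn)
      ⟨by show G 0 ≤ ℓ; rw [hG0]; exact hℓ0.le, hC.le⟩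
  obtain ⟨c, hcI, hc⟩ := hIVT
  have hcpos : 0 < c := by
    rcases hcI.1.eq_or_lt with h | h
    · exfalso
      rw [← h, hG0] at hc
      linarith
    · exact h
  refine ⟨c, ⟨hcpos, by show G c ^ J = L; rw [hc, hℓJ]⟩, ?_⟩
  rintro c' ⟨hc'pos, hc'⟩
  have hGc' : G c' = ℓ := by
    rw [← hℓJ] at hc'
    exact (pow_left_inj₀ measureReal_nonneg hℓ0.le hJ).1 hc'
  exact (pi_gaussianReal_sumSqErase_strictMonoOn.injOn (Set.mem_Ici.2 hc'pos.le)
    (Set.mem_Ici.2 hcpos.le)) (hGc'.trans hc.symm)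

/-- **Monotonicity of the calibration**: `G(c)^J < G(c')^J` with `c, c' ≥ 0` forces `c < c'` — a
more demanding table level, or more couplings at a fixed level, needs a larger per-coupling
threshold. [ours] -/
theorem kArm_sidak_threshold_lt_of_pow_lt {c c' : ℝ} (hc : 0 ≤ c) (hc' : 0 ≤ c') {J : ℕ}
    (h : ((Measure.pi fun _ : Fin (n + 2) => gaussianReal 0 1).real
        {z : Fin (n + 2) → ℝ | ∑ r ∈ univ.erase 0, z r ^ 2 ≤ c}) ^ J
      < ((Measure.pi fun _ : Fin (n + 2) => gaussianReal 0 1).real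
        {z : Fin (n + 2) → ℝ | ∑ r ∈ univ.erase 0, z r ^ 2 ≤ c'}) ^ J) :
    c < c' := by
  have hG := lt_of_pow_lt_pow_left₀ J measureReal_nonneg h
  exact (pi_gaussianReal_sumSqErase_strictMonoOn.lt_iff_lt (Set.mem_Ici.2 hc) (Set.mem_Ici.2 hc')).1 hG

end Null

/-! ## §3 The table: `J` independent couplings -/

section Table

variable {n : ℕ} {ι : Type*} [Fintype ι]
variable {Ωs : ι → Fin (n + 2) → Type*} [∀ j r, MeasurableSpace (Ωs j r)]
  {Ps : (j : ι) → (r : Fin (n + 2)) → Measure (Ωs j r)} [∀ j r, IsProbabilityMeasure (Ps j r)]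
variable {Ω' : Type*} [MeasurableSpace Ω'] {P' : Measure Ω'} [IsProbabilityMeasure P']

/-- **THE WHOLE TABLE OF `k`-ARM TESTS IS CALIBRATED AT `G(c)^J`.**  At each of `J = |ι|` couplings,
run as independent jobs, `R = n + 2` codes satisfy the hypotheses of
`Scoring/KArmHomogeneityCoverage` (same target per coupling, independent Gaussian limits, error
bars consistent a.s.).  Then the probability that the homogeneity statistic is `≤ c` at EVERY
coupling tends to `G(c)^J`. [ours] -/
theorem kArm_homogeneity_simultaneous_coverage
    {S V : (j : ι) → (r : Fin (n + 2)) → ℕ → Ωs j r → ℝ} {a : ι → ℝ}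
    {s : ι → Fin (n + 2) → ℝ} {Z : ι → Fin (n + 2) → Ω' → ℝ} (hs : ∀ j r, 0 < s j r)
    (hSm : ∀ j r k, Measurable (S j r k)) (hVm : ∀ j r k, Measurable (V j r k))
    (hclt : ∀ j r, TendstoInDistribution (fun (k : ℕ) ω => Real.sqrt k * (S j r k ω - a j)) atTop
      (Z j r) (fun _ => Ps j r) P')
    (hZm : ∀ j r, Measurable (Z j r))
    (hZ : ∀ j r, HasLaw (Z j r) (gaussianReal 0 (s j r).toNNReal) P')
    (hind : ∀ j, iIndepFun (Z j) P')
    (hV : ∀ j r, ∀ᵐ ω ∂(Ps j r), Tendsto (fun k : ℕ => (k : ℝ) * V j r k ω) atTop (𝓝 (s j r)))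
    (c : ℝ) :
    Tendsto (fun k : ℕ => (Measure.pi fun j => Measure.pi (Ps j)).real
        {ω : (j : ι) → (r : Fin (n + 2)) → Ωs j r | ∀ j,
          ∑ r, (S j r k (ω j r) - (∑ i, S j i k (ω j i) / V j i k (ω j i)) / (∑ i, (V j i k (ω j i))⁻¹)) ^ 2
            / V j r k (ω j r) ≤ c})
      atTop (𝓝 (((Measure.pi fun _ : Fin (n + 2) => gaussianReal 0 1).real
        {z : Fin (n + 2) → ℝ | ∑ r ∈ univ.erase 0, z r ^ 2 ≤ c}) ^ Fintype.card ι)) :=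
  CardConsistency.tendsto_measureReal_pi_forall_mem_const (fun j => Measure.pi (Ps j))
    (E := fun k j => {ω : (r : Fin (n + 2)) → Ωs j r |
      ∑ r, (S j r k (ω r) - (∑ i, S j i k (ω i) / V j i k (ω i)) / (∑ i, (V j i k (ω i))⁻¹)) ^ 2
        / V j r k (ω r) ≤ c})
    fun j => kArm_homogeneity_coverage (hs j) (hSm j) (hVm j) (hclt j) (hZm j) (hZ j) (hind j) (hV j) c

end Table

end Summit.Ventures.LatticeQCDFlow.Scoring
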